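import Mathlib.Analysis.InnerProductSpace.Calculus
import Mathlib.Analysis.SpecialFunctions.Trigonometric.DerivHyp
import Literature.Probability.LatticeModels.PlanarIsingOnePointProofs
import HarnessLib

/-!
# CHI's coefficient `𝒜_Ω(a; b)` and the logarithmic derivative of the explicit two-point function

Topic `Literature/Probability/LatticeModels`. Continuum layer of the programme behind
`Literature.Probability.LatticeModels.chi_onePoint_rho` (Chelkak–Hongler–Izyurov 2015, "CHI15").
CHI15 Theorem 1.5 identifies the limits of the discrete logarithmic derivatives of the `+` spin
correlations with `Re 𝒜_Ω` and `-Im 𝒜_Ω`, where `𝒜_Ω(a; b)` is the second coefficient of the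
continuous spinor at its branch point (Def. 2.11), computed explicitly in the half-plane (§2.7.2,
p. 16) and transported by the covariance rule (1.5). Remark 2.21 / §2.7 then assert — "straightforward
computations show" — that `∫ Re[𝒜_ℍ(z; b) dz]` is the logarithm of the explicit two-point function
(1.3). This file makes that computation a theorem, in the form consumed by the glue file
`LatticeRatioLimit.lean` (hypothesis `hD` there is phrased with the Fréchet derivative of
`w ↦ log ⟨σ_xσ_w⟩⁺_Ω`):

* `ACHI_H a b` — CHI's `𝒜_ℍ(a; b) = -1/(8i Im a) + (|b-ā|-|b-a|)/(4(|b-ā|+|b-a|)) · (1/(b-a) - 1/(b̄-a))`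
  (p. 16), and `ACHI φ w x := 𝒜_ℍ(φ w; φ x) φ'(w) + φ''(w)/(8 φ'(w))` — the covariance rule (1.5).
* `hasFDerivAt_log_twoPointPlusCHI`: for a conformal bijection `φ : Ω → ℍ`, `x ∈ Ω` and
  `w ∈ Ω ∖ {x}`, the function `w ↦ log ⟨σ_xσ_w⟩⁺_Ω = log (twoPointPlusCHI φ x w)` has Fréchet
  derivative `s ↦ Re (𝒜_Ω(w; x) s)` at `w`; `fderiv_log_twoPointPlusCHI_apply` is the `fderiv` form.

Proof: `log ⟨σ_xσ_w⟩⁺_Ω = ½ log (2 cosh (ρ/2)) - ⅛ log (2 Im φ w) + ⅛ log |φ'(w)| + const` with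
`ρ = log|φ w - φ x| - log|φ w - conj (φ x)|` (`u = e^{ρ/2}` in (1.3)); the elementary derivatives
`d log|z - c| = Re[dz/(z - c)]`, `d log Im z = Re[-i dz / Im z]`, `d log|g| = Re[g' dz / g]` and
`(log (2 cosh (ρ/2)))' = ½ tanh (ρ/2) = ½ (|a-b| - |a-b̄|)/(|a-b| + |a-b̄|)` assemble to `Re[𝒜_Ω dw]`.
Everything is proved; the two definitions are CHI's printed formulae.

## References

* D. Chelkak, C. Hongler, K. Izyurov, Ann. of Math. 181 (2015) = arXiv:1202.2838: Thm 1.5 and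
  eq. (1.5), Def. 2.11, Remark 2.12, §2.7 (p. 16), Remark 2.21 — `ChelkakHonglerIzyurovAnnals2015`.
-/

noncomputable section

open Filter Topology Metric Set Real Complex
open Literature.Probability.LatticeModels

namespace Literature.Probability.LatticeModels

/-! ### The coefficients -/

/-- **CHI's half-plane coefficient** `𝒜_ℍ(a; b)` (the term in front of `√(z-a)` in the expansion of
the continuous spinor `f_{[ℍ,a;b]}` at `a`, computed in §2.7.2):
`𝒜_ℍ(a; b) = -1/(8 i Im a) + (|b - ā| - |b - a|) / (4 (|b - ā| + |b - a|)) · (1/(b - a) - 1/(b̄ - a))`.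
[cite: ChelkakHonglerIzyurovAnnals2015, §2.7.2 (p. 16, formula for 𝒜_ℍ(a;b)) and Def. 2.11] -/
def ACHI_H (a b : ℂ) : ℂ :=
  -1 / (8 * I * (a.im : ℂ)) +
    ((‖b - (starRingEnd ℂ) a‖ - ‖b - a‖) / (4 * (‖b - (starRingEnd ℂ) a‖ + ‖b - a‖)) : ℝ) *
      (1 / (b - a) - 1 / ((starRingEnd ℂ) b - a))

/-- **CHI's coefficient `𝒜_Ω(w; x)` of a simply connected domain**, transported from `ℍ` by the
covariance rule (1.5) along a conformal map `φ : Ω → ℍ`: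
`𝒜_Ω(w; x) = 𝒜_ℍ(φ w; φ x) φ'(w) + φ''(w) / (8 φ'(w))`.
[cite: ChelkakHonglerIzyurovAnnals2015, eq. (1.5) and Remark 2.12] -/
def ACHI (φ : ℂ → ℂ) (w x : ℂ) : ℂ :=
  ACHI_H (φ w) (φ x) * deriv φ w + deriv (deriv φ) w / (8 * deriv φ w)

/-! ### Real-linear functionals `h ↦ Re (c h)` -/

/-- The real-linear functional `h ↦ Re (c · h)` on `ℂ`. [folklore] -/
def reMul (c : ℂ) : ℂ →L[ℝ] ℝ := Complex.reCLM.comp (c • ContinuousLinearMap.id ℝ ℂ)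

/-- `reMul c h = Re (c h)`. [folklore] -/
@[simp] theorem reMul_apply (c h : ℂ) : reMul c h = (c * h).re := by
  simp [reMul]

/-- `reMul` is additive in `c`. [folklore] -/
theorem reMul_add (c d : ℂ) : reMul c + reMul d = reMul (c + d) := by
  ext h; simp [add_mul]

/-- `reMul` is subtractive in `c`. [folklore] -/
theorem reMul_sub (c d : ℂ) : reMul c - reMul d = reMul (c - d) := by
  ext h; simp [sub_mul]

/-- `reMul` is real-homogeneous in `c`. [folklore] -/
theorem smul_reMul (r : ℝ) (c : ℂ) : r • reMul c = reMul ((r : ℂ) * c) := by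
  ext h
  simp [mul_assoc]

/-- Composition of `reMul c` with the real-linear map `h ↦ h d`. [folklore] -/
theorem reMul_comp_toSpanSingleton (c d : ℂ) :
    (reMul c).comp ((ContinuousLinearMap.toSpanSingleton ℂ d).restrictScalars ℝ) = reMul (c * d) := by
  ext h
  simp [ContinuousLinearMap.toSpanSingleton_apply, mul_comm h d, mul_assoc]

/-! ### Elementary logarithmic derivatives -/

/-- `d log |z - c| = Re [dz / (z - c)]` (`z ≠ c`). [folklore] -/
theorem hasFDerivAt_log_norm_sub {z c : ℂ} (hz : z ≠ c) :
    HasFDerivAt (fun z : ℂ => Real.log ‖z - c‖) (reMul (z - c)⁻¹) z := by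
  have hzc : z - c ≠ 0 := sub_ne_zero.2 hz
  have h1 : HasFDerivAt (fun z : ℂ => ‖z - c‖ ^ 2) (2 • (innerSL ℝ (z - c)).comp (ContinuousLinearMap.id ℝ ℂ)) z :=
    ((hasFDerivAt_id z).sub_const c).norm_sq
  rw [ContinuousLinearMap.comp_id, two_smul] at h1
  have hz2 : ‖z - c‖ ^ 2 ≠ 0 := pow_ne_zero 2 (norm_ne_zero_iff.2 hzc)
  have h2 := (h1.log hz2).const_smul (1 / 2 : ℝ)
  have h3 : HasFDerivAt (fun z : ℂ => Real.log ‖z - c‖)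
      ((1 / 2 : ℝ) • ((‖z - c‖ ^ 2)⁻¹ • (innerSL ℝ (z - c) + innerSL ℝ (z - c)))) z := by
    refine h2.congr_of_eventuallyEq (Eventually.of_forall fun w => ?_)
    simp only [Pi.smul_apply, smul_eq_mul]
    rw [Real.log_pow]; push_cast; ring
  refine h3.congr_fderiv ?_
  ext h
  have hn : Complex.normSq (z - c) ≠ 0 := (Complex.normSq_pos.2 hzc).ne'
  show (1 / 2 : ℝ) * ((‖z - c‖ ^ 2)⁻¹ * (inner ℝ (z - c) h + inner ℝ (z - c) h)) = ((z - c)⁻¹ * h).re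
  rw [Complex.inner, Complex.sq_norm, Complex.mul_re, Complex.mul_re, Complex.inv_re, Complex.inv_im,
    Complex.conj_re, Complex.conj_im]
  field_simp
  ring

/-- `d log |z| = Re [dz / z]` (`z ≠ 0`). [folklore] -/
theorem hasFDerivAt_log_norm_reMul {z : ℂ} (hz : z ≠ 0) :
    HasFDerivAt (fun z : ℂ => Real.log ‖z‖) (reMul z⁻¹) z := by
  have h := hasFDerivAt_log_norm_sub (c := 0) hz
  simp only [sub_zero] at h
  exact h

/-- `d log Im z = Re [-i dz / Im z]` (`Im z ≠ 0`). [folklore] -/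
theorem hasFDerivAt_log_im {z : ℂ} (hz : z.im ≠ 0) :
    HasFDerivAt (fun z : ℂ => Real.log z.im) (reMul (-I * ((z.im : ℂ))⁻¹)) z := by
  have h1 : HasFDerivAt (fun z : ℂ => z.im) Complex.imCLM z := Complex.imCLM.hasFDerivAt
  have h2 := h1.log hz
  refine h2.congr_fderiv ?_
  ext h
  have happ : ((z.im)⁻¹ • Complex.imCLM) h = (z.im)⁻¹ * h.im := by simp
  rw [happ, reMul_apply, ← Complex.ofReal_inv]
  simp only [Complex.mul_re, Complex.neg_re, Complex.neg_im, Complex.mul_im, Complex.I_re, Complex.I_im,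
    Complex.ofReal_re, Complex.ofReal_im]
  ring

/-- `d log |g| = Re [g' dz / g]` for `g` complex-differentiable at `z` with `g z ≠ 0`. [folklore] -/
theorem hasFDerivAt_log_norm_comp {g : ℂ → ℂ} {g' z : ℂ} (hg : HasDerivAt g g' z) (hz : g z ≠ 0) :
    HasFDerivAt (fun z : ℂ => Real.log ‖g z‖) (reMul (g' * (g z)⁻¹)) z := by
  have h := (hasFDerivAt_log_norm_reMul hz).comp z (hg.hasFDerivAt.restrictScalars ℝ)
  rw [reMul_comp_toSpanSingleton, mul_comm] at h
  exact h

/-- `(log (2 cosh (ρ/2)))' = ½ tanh (ρ/2)`. [folklore] -/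
theorem hasDerivAt_log_two_mul_cosh_half (ρ : ℝ) :
    HasDerivAt (fun ρ : ℝ => Real.log (2 * Real.cosh (ρ / 2))) (Real.tanh (ρ / 2) / 2) ρ := by
  have h1 : HasDerivAt (fun ρ : ℝ => ρ / 2) (1 / 2) ρ := (hasDerivAt_id ρ).div_const 2
  have h2 : HasDerivAt (fun ρ : ℝ => Real.cosh (ρ / 2)) (Real.sinh (ρ / 2) * (1 / 2)) ρ := (Real.hasDerivAt_cosh _).comp ρ h1
  have h3 : HasDerivAt (fun ρ : ℝ => 2 * Real.cosh (ρ / 2)) (2 * (Real.sinh (ρ / 2) * (1 / 2))) ρ := h2.const_mul 2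
  have hpos : 2 * Real.cosh (ρ / 2) ≠ 0 := (mul_pos two_pos (Real.cosh_pos _)).ne'
  have h4 := h3.log hpos
  convert h4 using 1
  rw [Real.tanh_eq_sinh_div_cosh]
  field_simp

/-- `tanh (ρ/2) = (N - D)/(N + D)` for `ρ = log N - log D`, `N, D > 0`. [folklore] -/
theorem tanh_half_log_sub_log {N D : ℝ} (hN : 0 < N) (hD : 0 < D) :
    Real.tanh ((Real.log N - Real.log D) / 2) = (N - D) / (N + D) := by
  rw [Real.tanh_eq_sinh_div_cosh, Real.sinh_eq, Real.cosh_eq]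
  have e1 : Real.exp ((Real.log N - Real.log D) / 2) = Real.sqrt N / Real.sqrt D := by
    rw [show (Real.log N - Real.log D) / 2 = Real.log N / 2 - Real.log D / 2 by ring, Real.exp_sub,
      show Real.log N / 2 = Real.log N * (1 / 2) by ring, show Real.log D / 2 = Real.log D * (1 / 2) by ring,
      Real.exp_mul, Real.exp_mul, Real.exp_log hN, Real.exp_log hD, Real.sqrt_eq_rpow, Real.sqrt_eq_rpow]
  have e2 : Real.exp (-((Real.log N - Real.log D) / 2)) = Real.sqrt D / Real.sqrt N := by
    rw [Real.exp_neg, e1, inv_div]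
  rw [e2, e1]
  have hsN : 0 < Real.sqrt N := Real.sqrt_pos.2 hN
  have hsD : 0 < Real.sqrt D := Real.sqrt_pos.2 hD
  have hN' : Real.sqrt N * Real.sqrt N = N := Real.mul_self_sqrt hN.le
  have hD' : Real.sqrt D * Real.sqrt D = D := Real.mul_self_sqrt hD.le
  field_simp
  nlinarith [hN', hD']

/-! ### The logarithmic derivative of the explicit two-point function -/

/-- `‖b - ā‖ = ‖a - b̄‖`. [folklore] -/
theorem norm_sub_conj_comm (a b : ℂ) : ‖b - (starRingEnd ℂ) a‖ = ‖a - (starRingEnd ℂ) b‖ := by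
  rw [← Complex.norm_conj (b - (starRingEnd ℂ) a), map_sub, Complex.conj_conj, norm_sub_rev]

/-- **The decomposition of `log ⟨σ_xσ_w⟩⁺_Ω`** used for differentiation:
`log ⟨σ_xσ_w⟩⁺_Ω = ½ log (2 cosh (ρ/2)) - ⅛ log (2 Im φ x) - ⅛ log (2 Im φ w) + ⅛ log|φ' x| + ⅛ log|φ' w|`,
`ρ = log|φ w - φ x| - log|φ w - conj(φ x)|` (so that `u = e^{ρ/2}` in (1.3)), valid where all the
quantities are positive. [cite: ChelkakHonglerIzyurovAnnals2015, eqs. (1.2)–(1.3)] -/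
theorem log_twoPointPlusCHI_eq {φ : ℂ → ℂ} {x w : ℂ} (hN : 0 < ‖φ w - φ x‖) (hD : 0 < ‖φ w - (starRingEnd ℂ) (φ x)‖)
    (hix : 0 < (φ x).im) (hiw : 0 < (φ w).im) (hdx : deriv φ x ≠ 0) (hdw : deriv φ w ≠ 0) :
    Real.log (twoPointPlusCHI φ x w) =
      (1 / 2) * Real.log (2 * Real.cosh ((Real.log ‖φ w - φ x‖ - Real.log ‖φ w - (starRingEnd ℂ) (φ x)‖) / 2)) -
        (1 / 8) * Real.log (2 * (φ x).im) - (1 / 8) * Real.log (2 * (φ w).im) +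
        (1 / 8) * Real.log ‖deriv φ x‖ + (1 / 8) * Real.log ‖deriv φ w‖ := by
  set N := ‖φ w - φ x‖ with hNdef
  set D := ‖φ w - (starRingEnd ℂ) (φ x)‖ with hDdef
  set ρ := Real.log N - Real.log D with hρ
  have hu : uCHI (φ x) (φ w) = Real.exp (ρ / 2) := by
    unfold uCHI
    rw [← hNdef, ← hDdef, Real.rpow_def_of_pos (div_pos hN hD), Real.log_div hN.ne' hD.ne', ← hρ]
    congr 1; ring
  have hsum : uCHI (φ x) (φ w) + (uCHI (φ x) (φ w))⁻¹ = 2 * Real.cosh (ρ / 2) := by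
    rw [hu, Real.cosh_eq, ← Real.exp_neg]; ring
  have hcosh : 0 < 2 * Real.cosh (ρ / 2) := mul_pos two_pos (Real.cosh_pos _)
  have hA : 0 < (2 * (φ x).im) ^ ((1 : ℝ) / 8) := Real.rpow_pos_of_pos (by positivity) _
  have hB : 0 < (2 * (φ w).im) ^ ((1 : ℝ) / 8) := Real.rpow_pos_of_pos (by positivity) _
  have hC : 0 < ‖deriv φ x‖ ^ ((1 : ℝ) / 8) := Real.rpow_pos_of_pos (norm_pos_iff.2 hdx) _
  have hE : 0 < ‖deriv φ w‖ ^ ((1 : ℝ) / 8) := Real.rpow_pos_of_pos (norm_pos_iff.2 hdw) _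
  unfold twoPointPlusCHI
  rw [hsum, Real.log_mul (div_pos (Real.sqrt_pos.2 hcosh) (mul_pos hA hB)).ne' (mul_pos hC hE).ne',
    Real.log_div (Real.sqrt_pos.2 hcosh).ne' (mul_pos hA hB).ne', Real.log_mul hA.ne' hB.ne', Real.log_mul hC.ne' hE.ne',
    Real.log_sqrt hcosh.le, Real.log_rpow (by positivity : 0 < 2 * (φ x).im), Real.log_rpow (by positivity : 0 < 2 * (φ w).im),
    Real.log_rpow (norm_pos_iff.2 hdx), Real.log_rpow (norm_pos_iff.2 hdw)]
  ring

/-- **The logarithmic derivative of CHI's explicit two-point function is `Re[𝒜_Ω dw]`** (CHI15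
Remark 2.21 / §2.7: the primitive of `Re[𝒜_ℍ(z; b) dz]` "coincides with `log ⟨σ_aσ_b⟩⁺_ℍ` given by
(1.3)", transported to `Ω` by (1.2) and (1.5)): for a conformal bijection `φ : Ω → ℍ`, `x ∈ Ω` and
`w ∈ Ω`, `w ≠ x`, the function `w ↦ log ⟨σ_xσ_w⟩⁺_Ω` has Fréchet derivative `s ↦ Re (𝒜_Ω(w; x) s)`
at `w`. [cite: ChelkakHonglerIzyurovAnnals2015, Remark 2.21 and §2.7.2; eq. (1.5); Thm. 1.5] -/
theorem hasFDerivAt_log_twoPointPlusCHI {Ω : Set ℂ} (hΩo : IsOpen Ω) {φ : ℂ → ℂ}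
    (hφ : IsConformalBijection φ Ω UpperHalfPlane.upperHalfPlaneSet) {x w : ℂ} (hx : x ∈ Ω) (hw : w ∈ Ω)
    (hwx : w ≠ x) :
    HasFDerivAt (fun w => Real.log (twoPointPlusCHI φ x w)) (reMul (ACHI φ w x)) w := by
  -- the open set where the decomposition holds
  set S := Ω \ {x} with hS
  have hSo : IsOpen S := hΩo.sdiff isClosed_singleton
  have hwS : w ∈ S := ⟨hw, hwx⟩
  have hφan : AnalyticOnNhd ℂ φ Ω := hφ.1.analyticOnNhd hΩo
  have him : ∀ z ∈ Ω, 0 < (φ z).im := fun z hz => hφ.2.mapsTo hz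
  have hder : ∀ z ∈ Ω, deriv φ z ≠ 0 := fun z hz =>
    Literature.Analysis.Complex.SCV.deriv_ne_zero_of_injOn hφ.1 hΩo hφ.2.injOn hz
  have hN : ∀ z ∈ S, 0 < ‖φ z - φ x‖ := fun z hz =>
    norm_pos_iff.2 (sub_ne_zero.2 fun h => hz.2 (hφ.2.injOn hz.1 hx h))
  have hD : ∀ z ∈ S, 0 < ‖φ z - (starRingEnd ℂ) (φ x)‖ := fun z hz => by
    refine norm_pos_iff.2 (sub_ne_zero.2 fun h => ?_)
    have h' := congrArg Complex.im h
    rw [Complex.conj_im] at h'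
    linarith [him z hz.1, him x hx]
  have hab : φ w ≠ φ x := sub_ne_zero.1 (norm_pos_iff.1 (hN w hwS))
  have hab' : φ w ≠ (starRingEnd ℂ) (φ x) := sub_ne_zero.1 (norm_pos_iff.1 (hD w hwS))
  -- abbreviations
  set ρfun : ℂ → ℝ := fun z => Real.log ‖φ z - φ x‖ - Real.log ‖φ z - (starRingEnd ℂ) (φ x)‖ with hρfun
  set ρ := ρfun w with hρ
  set c₁ : ℂ := ((φ w - φ x)⁻¹ - (φ w - (starRingEnd ℂ) (φ x))⁻¹) * deriv φ w with hc₁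
  set c₂ : ℂ := -I * (((φ w).im : ℂ))⁻¹ * deriv φ w with hc₂
  set c₃ : ℂ := deriv (deriv φ) w * (deriv φ w)⁻¹ with hc₃
  -- the derivative of `φ` at `w` and of `deriv φ` at `w`
  have hφw : HasDerivAt φ (deriv φ w) w := ((hφan w hw).differentiableAt).hasDerivAt
  have hφ'w : HasDerivAt (deriv φ) (deriv (deriv φ) w) w := ((hφan.deriv w hw).differentiableAt).hasDerivAt
  -- (1) `ρ`
  have hρ' : HasFDerivAt ρfun (reMul c₁) w := by
    have h1 := (hasFDerivAt_log_norm_sub hab).comp w (hφw.hasFDerivAt.restrictScalars ℝ)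
    have h2 := (hasFDerivAt_log_norm_sub hab').comp w (hφw.hasFDerivAt.restrictScalars ℝ)
    rw [reMul_comp_toSpanSingleton] at h1 h2
    have h := h1.sub h2
    rw [reMul_sub, ← sub_mul] at h
    exact h
  -- (2) `½ log (2 cosh (ρ/2))`
  have hF : HasFDerivAt (fun z => (1 / 2 : ℝ) * Real.log (2 * Real.cosh (ρfun z / 2)))
      (reMul (((Real.tanh (ρ / 2) / 4 : ℝ) : ℂ) * c₁)) w := by
    have h : HasFDerivAt (fun z => (1 / 2 : ℝ) * Real.log (2 * Real.cosh (ρfun z / 2)))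
        ((1 / 2 : ℝ) • ((Real.tanh (ρ / 2) / 2) • reMul c₁)) w :=
      ((hasDerivAt_log_two_mul_cosh_half ρ).comp_hasFDerivAt w hρ').const_mul (1 / 2 : ℝ)
    rw [smul_reMul, smul_reMul, ← mul_assoc] at h
    convert h using 3
    push_cast; ring
  -- (3) `⅛ log (2 Im φ z)`
  have hI : HasFDerivAt (fun z => (1 / 8 : ℝ) * Real.log (2 * (φ z).im)) (reMul (((1 / 8 : ℝ) : ℂ) * c₂)) w := by
    have h1 := (hasFDerivAt_log_im (z := φ w) (him w hw).ne').comp w (hφw.hasFDerivAt.restrictScalars ℝ)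
    rw [reMul_comp_toSpanSingleton] at h1
    have h2 : HasFDerivAt (fun z => Real.log (2 * (φ z).im)) (reMul c₂) w := by
      refine (h1.const_add (Real.log 2)).congr_of_eventuallyEq ?_
      filter_upwards [hΩo.mem_nhds hw] with z hz
      simp only [Function.comp]
      rw [Real.log_mul two_ne_zero (him z hz).ne']
    have h3 : HasFDerivAt (fun z => (1 / 8 : ℝ) * Real.log (2 * (φ z).im)) ((1 / 8 : ℝ) • reMul c₂) w := h2.const_mul (1 / 8 : ℝ)
    rwa [smul_reMul] at h3
  -- (4) `⅛ log |φ' z|`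
  have hG : HasFDerivAt (fun z => (1 / 8 : ℝ) * Real.log ‖deriv φ z‖) (reMul (((1 / 8 : ℝ) : ℂ) * c₃)) w := by
    have h : HasFDerivAt (fun z => (1 / 8 : ℝ) * Real.log ‖deriv φ z‖) ((1 / 8 : ℝ) • reMul c₃) w :=
      (hasFDerivAt_log_norm_comp hφ'w (hder w hw)).const_mul (1 / 8 : ℝ)
    rwa [smul_reMul] at h
  -- assembling the decomposition
  have hdec : (fun z => Real.log (twoPointPlusCHI φ x z)) =ᶠ[𝓝 w]
      fun z => (1 / 2 : ℝ) * Real.log (2 * Real.cosh (ρfun z / 2)) - (1 / 8) * Real.log (2 * (φ x).im) -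
        (1 / 8 : ℝ) * Real.log (2 * (φ z).im) + (1 / 8) * Real.log ‖deriv φ x‖ + (1 / 8 : ℝ) * Real.log ‖deriv φ z‖ := by
    filter_upwards [hSo.mem_nhds hwS] with z hz
    exact log_twoPointPlusCHI_eq (hN z hz) (hD z hz) (him x hx) (him z hz.1) (hder x hx) (hder z hz.1)
  have hsumD := (((hF.sub_const ((1 / 8 : ℝ) * Real.log (2 * (φ x).im))).sub hI).add_const
    ((1 / 8 : ℝ) * Real.log ‖deriv φ x‖)).add hG
  have key : HasFDerivAt (fun z => Real.log (twoPointPlusCHI φ x z))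
      (reMul (((Real.tanh (ρ / 2) / 4 : ℝ) : ℂ) * c₁) - reMul (((1 / 8 : ℝ) : ℂ) * c₂) + reMul (((1 / 8 : ℝ) : ℂ) * c₃)) w :=
    hsumD.congr_of_eventuallyEq hdec
  -- the coefficient is `𝒜_Ω(w; x)`
  refine key.congr_fderiv ?_
  rw [reMul_sub, reMul_add]
  congr 1
  -- algebra
  have htanh : Real.tanh (ρ / 2) = (‖φ w - φ x‖ - ‖φ w - (starRingEnd ℂ) (φ x)‖) / (‖φ w - φ x‖ + ‖φ w - (starRingEnd ℂ) (φ x)‖) := by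
    rw [hρ]
    exact tanh_half_log_sub_log (hN w hwS) (hD w hwS)
  have h1 : φ w - φ x ≠ 0 := sub_ne_zero.2 hab
  have h2 : φ w - (starRingEnd ℂ) (φ x) ≠ 0 := sub_ne_zero.2 hab'
  have h3 : φ x - φ w ≠ 0 := fun h => h1 (by rw [← neg_sub, h, neg_zero])
  have h4 : (starRingEnd ℂ) (φ x) - φ w ≠ 0 := fun h => h2 (by rw [← neg_sub, h, neg_zero])
  have hima : (((φ w).im : ℝ) : ℂ) ≠ 0 := by exact_mod_cast (him w hw).ne'
  have hφ' : deriv φ w ≠ 0 := hder w hw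
  have hsum : ((‖φ w - φ x‖ + ‖φ w - (starRingEnd ℂ) (φ x)‖ : ℝ) : ℂ) ≠ 0 := by
    have : 0 < ‖φ w - φ x‖ + ‖φ w - (starRingEnd ℂ) (φ x)‖ := add_pos (hN w hwS) (hD w hwS)
    exact_mod_cast this.ne'
  have h8 : (8 : ℂ) ≠ 0 := by norm_num
  simp only [hc₁, hc₂, hc₃, ACHI, ACHI_H, htanh, norm_sub_conj_comm (φ w) (φ x), norm_sub_rev (φ x) (φ w)]
  push_cast
  field_simp
  ring_nf
  rw [Complex.I_sq]
  ring

/-- The `fderiv` form: `D(log ⟨σ_xσ_·⟩⁺_Ω)(w)[s] = Re (𝒜_Ω(w; x) s)` — the identification of the limit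
in hypothesis `hD` of `LatticeRatioLimit.chi_onePoint_rho_of_logDerivative` with CHI's `Re[𝒜_Ω · s]`
(for the diagonal steps `s = ±1 ± i`: `Re 𝒜 ∓ Im 𝒜`, cf. the two lines of CHI15 (1.4)).
[cite: ChelkakHonglerIzyurovAnnals2015, Thm. 1.5 and Remark 2.21] -/
theorem fderiv_log_twoPointPlusCHI_apply {Ω : Set ℂ} (hΩo : IsOpen Ω) {φ : ℂ → ℂ}
    (hφ : IsConformalBijection φ Ω UpperHalfPlane.upperHalfPlaneSet) {x w : ℂ} (hx : x ∈ Ω) (hw : w ∈ Ω)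
    (hwx : w ≠ x) (s : ℂ) :
    fderiv ℝ (fun w => Real.log (twoPointPlusCHI φ x w)) w s = (ACHI φ w x * s).re := by
  rw [(hasFDerivAt_log_twoPointPlusCHI hΩo hφ hx hw hwx).fderiv, reMul_apply]

end Literature.Probability.LatticeModels
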